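import Summits.BirchSwinnertonDyer.BirchSwinnertonDyer.Theorems.RamifiedSevenEllipticUnitsIndexIffControl
import Summits.BirchSwinnertonDyer.Rank1Residual.X12.O11.RouteUMember11
import Summits.BirchSwinnertonDyer.Rank1Residual.X12.O11.RouteUIsogenous
import HarnessLib

set_option linter.dupNamespace false
set_option autoImplicit false

/-!
# Route `RamifiedSevenEllipticUnits` (rung K7r) — BC5 / tribunal t3 WITNESS for the crux
# `EllipticUnitIndexSeven` (stmt-BirchSwinnertonDyer-19143) at the unit-case member `5929e1 = 49a1^{(−11)}`

Cell `bsd-cm`, seat `bsd-cm-ram` (g5); planner ORDER v5.3.14 (2) «`stub_ellipticUnitIndexSeven_D11` as a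
theorem `--supports stmt-BirchSwinnertonDyer-19143`». HONEST READING: the crux `(R-EU)@7` is a statement
about the constructed anticyclotomic Selmer dual `AcSelmer.XAc`, so no member instance of it is provable
outright in the kernel today. What IS provable for the member `W ≅ 49a1^{(−11)}` (Route U, p405323 /
p404516: `BSD(W, 7)` from Kriz–Li Thm 1.20 + two Bernoulli–Hurwitz certificates + named facts, and
`BSD(V, 7)` for every globally minimal `V` isogenous to `W` by Cassels, `TwistComparison.bsdp_of_bsdp_of_isIsogenous`):
**`(R-EU)@7` at `W` FOLLOWS FROM `(R-ctrl)@7` at `W`** (`ellipticUnitIndexAt_of_strictControlAt_of_bsdp_isogenyClass`,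
p409726). So at this member the crux `EllipticUnitIndexSeven` carries no content beyond the crux
`StrictControlSeven` — the witness the tribunal asks for, in the only form the tree can state it.
Displayed binders: exactly those of `RouteU.bsdp_seven_of_twist_cm7_D11_byClass` (9 named facts, the
analytic `hr1`/`hLt`, Heegner / Mordell–Weil / twin data, `hc7`) + Cassels (`hCassels`) + `(R-ctrl)@7`.
Nothing is asserted; no named fact is minted; nothing closes.
-/

noncomputable section

open scoped Classical

open WeierstrassCurve NumberField
  Literature.NumberTheory.EllipticCurves
  Literature.NumberTheory.EllipticCurves.Rank1Residual
  Literature.NumberTheory.EllipticCurves.KrizLi2019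
  Literature.NumberTheory.EllipticCurves.ModularForms
  Summit.BirchSwinnertonDyer.Rank1Residual.X12.O11

namespace Summit.BirchSwinnertonDyer.BirchSwinnertonDyer.Theorems.RamifiedSevenEllipticUnits

/-- **t3 witness `stub_ellipticUnitIndexSeven_D11`: at the unit-case member `5929e1 = 49a1^{(−11)}` the
crux `(R-EU)@7` (`O11.RamifiedCMEllipticUnitIndexAt W 7`) follows from the crux `(R-ctrl)@7`
(`O11.RamifiedCMStrictControlAt W 7`)**, because Route U gives `BSD(V, 7)` on the whole `ℚ`-isogeny class
of `W` (`RouteU.bsdp_seven_of_twist_cm7_D11_byClass` with its displayed binders, transported by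
`Additive.TwistComparison.bsdp_of_bsdp_of_isIsogenous` and Cassels' `bsdRHS_eq_of_isIsogenous`), and
(R-EU) ⟸ (R-ctrl) ∧ BSD₇ on the isogeny class (`ellipticUnitIndexAt_of_strictControlAt_of_bsdp_isogenyClass`).
[cite: KrizLi2019, Thm. 1.20 and Rem. 3.10] [cite: Cassels1965ArithmeticVIII]
[cite: Miller2011LMS, §1 and Def. 1.1 (arXiv:1010.2431 p. 3)] -/
theorem stub_ellipticUnitIndexSeven_D11
    (W : WeierstrassCurve ℚ) [W.IsElliptic] [W.IsGloballyMinimal] [NeZero (W.conductorNorm ℤ)]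
    (hctrl : RamifiedCMStrictControlAt W 7)
    (hKL : KrizLi2019.thm120_padicLogHeegner_unit_of_bernoulli)
    (hRem : KrizLi2019.rem310_padicLogHeegner_integral)
    (hW : ∃ C : VariableChange ℚ, C • W = cm7.quadraticTwist ((-(11 : ℕ) : ℤ) : ℚ))
    (K : Type) [Field K] [NumberField K] [NeZero (NumberField.discr K).natAbs]
    (hK : IsImaginaryQuadratic K) (hdK : NumberField.discr K = -(19 : ℕ))
    (D : ModularParametrizationData W (W.conductorNorm ℤ))
    (H : HeegnerDatum (W.conductorNorm ℤ) (NumberField.discr K)) (ι : K →+* ℂ) (ιp : K →+* ℚ_[7])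
    (P : (W.baseChange K).toAffine.Point)
    (hGZ : gross_zagier (W.conductorNorm ℤ) W K) (hKo : kolyvagin (W.conductorNorm ℤ) W K)
    (hGZK : rank_eq_analyticRank_of_analyticRank_le_one) (hmod : hasEntireLFunction_rat)
    (hP : WeierstrassCurve.Affine.Point.map ι.toRatAlgHom P = heegnerPointComplex D H)
    (hr1 : W.analyticRank = 1)
    (hLt : (W.quadraticTwist (NumberField.discr K : ℚ)).entireLFunction 1 ≠ 0)
    (Wd : WeierstrassCurve ℚ) [Wd.IsElliptic] [Wd.IsGloballyMinimal] (Cd : VariableChange ℚ)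
    (hWd : Cd • W.quadraticTwist (NumberField.discr K : ℚ) = Wd)
    (hBF : bsdTriple_of_hasCM_of_L_one_ne_zero)
    (hu : padicValRat 7 (Cd.u : ℚ) = 0)
    (hC : Rubin1983.thmC_seven_quadraticField)
    (hBG : BuhlerGross1985.firstDescent_seven_oddTwist_of_bernoulli)
    [Finite (AddCommGroup.torsion (W.baseChange K).toAffine.Point)]
    (crd : (W.baseChange K).toAffine.Point →+ ℤ) (g : (W.baseChange K).toAffine.Point)
    (hg : crd g = 1) (hker : ∀ x, crd x = 0 → IsOfFinAddOrder x)
    (hc7 : ¬ ((7 : ℤ) ∣ D.c)) (hCassels : bsdRHS_eq_of_isIsogenous) :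
    RamifiedCMEllipticUnitIndexAt W 7 :=
  ellipticUnitIndexAt_of_strictControlAt_of_bsdp_isogenyClass (p := 7) hctrl fun V _ _ hiso =>
    Summit.BirchSwinnertonDyer.Rank1Residual.Additive.TwistComparison.bsdp_of_bsdp_of_isIsogenous W V 7
      hCassels hGZK hmod hiso hr1.le
      (RouteU.bsdp_seven_of_twist_cm7_D11_byClass hKL hRem W hW K hK hdK D H ι ιp P hGZ hKo hGZK hmod
        hP hr1 hLt Wd Cd hWd hBF hu hC hBG crd g hg hker hc7)

end Summit.BirchSwinnertonDyer.BirchSwinnertonDyer.Theorems.RamifiedSevenEllipticUnits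

end
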